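import Summits.NavierStokesRegularity.FluidComputer.TubeTablePost13
import HarnessLib

/-!
# Kernel run of the post-ramp box tube, chunks 18 … 23 (bp3 gen 16)

HONEST FRAMING: low prior, high value-of-information experiment on Tao's machine paradigm; NOT a
claim that NS blows up.

Kernel evaluations (`decide +kernel`; no `native_decide`, no extra axioms) of the in-tree tube checker
`runTube` (`P = 60`, 12 Taylor terms, cube `Rt`, read-out `CLt`) on the chunks `cP13 18 … cP13 23`
(= design chunks `cT 31 … cT 36`) of `TubeTablePost13.lean`, each from the recorded boundary
state `sP13 i` to `sP13 (i+1)`.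

[cite: Tao2016AveragedNS, §5.5 Thm 5.3 (5.5)]
-/

namespace Summit.NavierStokesRegularity.FluidComputer

namespace TubeTablePost13

open Literature.Analysis.FluidPDE.FluidComputer Literature.Analysis.FluidPDE.FluidComputer.TubeTable
open Literature.Analysis.FluidPDE.FluidComputer.ThresholdLevelTable (GIt)

set_option maxHeartbeats 10000000 in
set_option maxRecDepth 200000 in
/-- Chunk 18 of the post-ramp tube run (design chunk 31: 50 steps at `h = 2^-11`). [folklore] -/
theorem runP13_18 : runTube 60 12 GIt CLt Rt (sP13 18) (cP13 18) = some (sP13 (18 + 1)) := by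
  decide +kernel

set_option maxHeartbeats 10000000 in
set_option maxRecDepth 200000 in
/-- Chunk 19 of the post-ramp tube run (design chunk 32: 50 steps at `h = 2^-11`). [folklore] -/
theorem runP13_19 : runTube 60 12 GIt CLt Rt (sP13 19) (cP13 19) = some (sP13 (19 + 1)) := by
  decide +kernel

set_option maxHeartbeats 10000000 in
set_option maxRecDepth 200000 in
/-- Chunk 20 of the post-ramp tube run (design chunk 33: 50 steps at `h = 2^-11`). [folklore] -/
theorem runP13_20 : runTube 60 12 GIt CLt Rt (sP13 20) (cP13 20) = some (sP13 (20 + 1)) := by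
  decide +kernel

set_option maxHeartbeats 10000000 in
set_option maxRecDepth 200000 in
/-- Chunk 21 of the post-ramp tube run (design chunk 34: 50 steps at `h = 2^-11`). [folklore] -/
theorem runP13_21 : runTube 60 12 GIt CLt Rt (sP13 21) (cP13 21) = some (sP13 (21 + 1)) := by
  decide +kernel

set_option maxHeartbeats 10000000 in
set_option maxRecDepth 200000 in
/-- Chunk 22 of the post-ramp tube run (design chunk 35: 50 steps at `h = 2^-11`). [folklore] -/
theorem runP13_22 : runTube 60 12 GIt CLt Rt (sP13 22) (cP13 22) = some (sP13 (22 + 1)) := by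
  decide +kernel

set_option maxHeartbeats 10000000 in
set_option maxRecDepth 200000 in
/-- Chunk 23 of the post-ramp tube run (design chunk 36: 50 steps at `h = 2^-11`). [folklore] -/
theorem runP13_23 : runTube 60 12 GIt CLt Rt (sP13 23) (cP13 23) = some (sP13 (23 + 1)) := by
  decide +kernel

end TubeTablePost13

end Summit.NavierStokesRegularity.FluidComputer
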